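import Summits.HubbardSuperconductivity.HubbardSuperconductivity.Theorems.AnisotropyChordTransferFibre3RowCXSCells
import Summits.HubbardSuperconductivity.HubbardSuperconductivity.Theorems.AnisotropyChordTransferFibre3N1RowL2N17162

/-!
# Route `AnisotropyChord` / H0 rotor rung, LEVEL 2 row C (KT-2b): the `ν`-column `[17162, 17848]/10⁶` — the X-sum bracket

The `ν`-cell `ν = λ₂/θ² ∈ [0.017162, 0.017848]` (p2's column `colN17162`): the L-uniform bracket of the positive Parseval sum of the
phase-defect moment, ★ `xsN17162` : `RowC.xsCellCheck 128 … (455/100) = true` — for every `L ≥ 128` and every `ν` in the column,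
`XSn(L, νθ²) ≤ 455/100` (window `K = 32` pointwise majorants + tail by the column's certified totals `θ⁴S₂ ≤ 6223822981/1000000000`,
`θ⁴T10 ≤ 59578229/15625000`; `RowC.xs_cell_sound`; exact-ℚ mirror value 4.5275); one kernel `decide` (≈ 75 s); shared by all `a`-cells
of this column (files `…RowCL2N17162A….lean`).
Prover seat `hubbard-h0-rotor-p1` g28 (route lead); helper for piece A = stmt-HubbardSuperconductivity-23918 of rung 19089
(`--supports`, helper class).  Nothing here proves superconductivity in the Hubbard model; one kernel-certified piece of ONE
conditional reduction (the GM₃ ∀L certificate, Level-2 row C = KT-2b); the rotor TARGET as originally worded stays FALSE (g15 verdict).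
Mathlib + the tree only; no sorry.  Generated by p1 g28's rowc/mkfiles.py (HOME/hubbard-h0-rotor-p1/rowc/).
-/

set_option linter.dupNamespace false
set_option autoImplicit false

open Literature.Analysis.ValidatedNumerics

namespace Summit.HubbardSuperconductivity.HubbardSuperconductivity.Theorems.AnisotropyChord.Transfer.Fibre3.L2.KT2b

open L2.N1

/-- ★ the X-sum bracket of the column `colN17162`: `XSn ≤ 455/100` for all `L ≥ 128`, `ν ∈ [17162, 17848]/10⁶` (kernel evaluation of `RowC.xsCellCheck`). -/
theorem xsN17162 :
    RowC.xsCellCheck 128 colN17162.n1 colN17162.n2 colN17162.νd colN17162.Tn colN17162.Td 1000000 colN17162.bS2.2 colN17162.bT10.2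
      ((455 : ℚ) / 100) = true := by
  decide +kernel

end Summit.HubbardSuperconductivity.HubbardSuperconductivity.Theorems.AnisotropyChord.Transfer.Fibre3.L2.KT2b
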